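import Summits.QuantumFields.YangMills.Theorems.UnitScaleTiltHalvingDbarStairSizes
import Summits.QuantumFields.YangMills.Theorems.UnitScaleTiltProp8ChartDoubleBarSU2
import HarnessLib

/-!
# Line H (`BirthV10.stub_halvingStep`, stmt-QuantumFields-19200) — (M2′) (b)-row toolbox, the FIELD-SIDE ROW (F-hU) of brick (B-al-4)₃:
# ★★ THE TORUS DOUBLE-BAR TOWER OF THE PRE-GAUGED MEMBER FIELD IS UNITARY ON THE LABEL BOXES, k-UNIFORMLY — a label-box induction with PER-LEVEL smallness
# ([Balaban1987RG1] (0.4)–(0.9); [Balaban1985Averaging] (89), (110), Prop. 4; [Balaban1985RegularSpaces] (1.19)–(1.20), (1.30))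

Cell `ym3-torus` (HUMAN RULING D-0037: YM₃ on T³ is ladder rung R3 — NOT d = 4, NOT infinite volume, NOT a mass gap, NOT the Clay problem), width seat `ym-ust-19200-w3`
gen 11 (B-al lineage; CLAIM 2026-08-29T04:41:48Z; consumer ym-ust-20520-w3 g9 ■ FINAL 04:49:24Z: «(F-hU) must be GENUINE unitarity `∈ Matrix.unitaryGroup (Fin 2) ℂ` … a
territory-box (F-hU) impl[ies the skeleton's `hStairU`] by restriction»; px10 g4 LOCATE 04:51:05Z (2): the k-uniform route is PER LEVEL via ✓`Prop8ChartDoubleBarSU2.pred_dbarAvgU`).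
`--supports stmt-QuantumFields-19200 --as helper`; THEOREMS ONLY (0 `def`, 0 `sorry`); count-neutral; nothing here claims B-al-2, (B-al-4)₃, the (b)-row, (M2′), the stub, the crux
or the gap.

WHY.  The (B-al-4) induction ✓`HalvingEffGaugeTowerRatio[Local].norm_effGauge_ratio_le_of_pyramid[_local]` needs the centre-stair transporters of `U̿^{(j)}X̂` in `U1` — on `M₂(ℂ)`
with the operator norm that is GENUINE UNITARITY.  The tree's supplier ✓`P1FlatCoreFrameLinStar.holT_stair_dbarIterU_mem_unitaryGroup_of_reads` (and ✓`Prop8ChartDoubleBarSU2.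
dbarIterU_mem_unitaryGroup_of_reads`) carries the budget `30400·ℓ²·Lⁱ·s₀ ≤ 1` on the FINE field's bond smallness — not uniform in the number of levels.  Here the smallness is read
PER LEVEL from the comb side, exactly as in the companion ✓`HalvingDbarStairSizes`: B-al-2's defect row `H_i` puts `U̿^{(i)}X̂` within `(102∕100)r_i` of the comb average
`C_i = avgIter L U′ i` through the cover, and the door's TOWER ROW puts `C_i` within `s` of `1` on the level-`i` label box; one double-bar step then preserves unitarity
(✓`pred_dbarAvgU`, window `12ℓ·(s + (102∕100)r⋆) ≤ 1`, no `Lⁱ`).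

WHAT IS PROVED (namespace `…Theorems.HalvingDbarStairUnitary`).
* §1 label-box bookkeeping: `inBox_succ_of_inBox_bondHi` (the corner box of an `L`-bond of the level-`n` box lies in the level-`(n+1)` box), `boxVec_mem_succ` (so does every block).
* §2 (generic multiplicative `eml`-stable predicate `p`, any `P : Params`, any comb family `C : ℕ → ℤᵈ-fields`): ★★ `pred_dbarIterU_of_levelSmall` — THE LABEL-BOX INDUCTION:
  `p` on the fine field + defect row + tower row + windows ⇒ `p ((U̿^{(i)}X)(π_i x, μ))` on every bond of the level-`i` box `[tlo L lo (k−i), thi L hi (k−i)]`, `i ≤ k`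
  (two-block bonds lifted by ★w3 g10 ✓`lift_twoBlock_bond`); ★★ `pred_holT_stair_dbarIterU_of_levelSmall` — and on every centre stair over the level-`(j+1)` box
  (✓`HalvingDbarStairSizes.lift_block_bond`, ✓`holT_pred_of_walk`); ★★ `holT_stair_dbarIterU_mem_unitaryGroup_of_levelSmall` — the instance `p := (· ∈ U(2))`
  (✓`eml_mem_unitaryGroup`, ✓`coe_units_inv_mem_unitaryGroup`).
* §3 (member level): ★★★ `stairUnitary_of_levelDefect` — in the B-al-3 door's row-`hG` guard letters (tower row `< s` on `[tlo L lo m′, thi L hi m′]`, `m′ ≤ K − n`, field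
  `avgIter L U′ (K − n − m′)`; `lo hi` abstract — the door reads `tLo a ρ′`, `tHi a M′ ρ′`) plus the displayed per-level defect row `hdef` and three scalar windows:
  `∀ j < K−n, ∀ w ∈ [tlo L lo (K−n−(j+1)), thi L hi (K−n−(j+1))], ∀ idx, U̿^{(j)}X̂(Γ_idx(π_{j+1} w)) ∈ Matrix.unitaryGroup (Fin 2) ℂ` — the skeleton `hG_of_rows`' row `hStairU`
  on the tower row's own boxes (its `sqLo∕sqHi` boxes lie inside the `tLo∕tHi` ones).
HONEST SCOPE.  Bookkeeping over landed bricks (✓`pred_dbarAvgU` carries the analysis); no new estimate.  The row `hdef` is B-al-2's induction invariant (px3 g5's per-level export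
pins `r j := 240c₁δc²ε₀²(Lʲ)⁴(Lᵏ)⁻⁴` modulo the step (B-iv)).  Nothing of Prop. 3∕4, Theorem 4, (M2′) or the stub is proved here.

References: T. Bałaban, CMP **109** (1987) 249–301 [Balaban1987RG1] ((0.1)–(0.4) pp.251–253, (0.9) p.253); CMP **98** (1985) 17–51 [Balaban1985Averaging] ((9) p.18,
(19) p.21, (89) p.31, (110) p.34, Prop. 4 (134)–(135) pp.38–39); CMP **99** (1985) 75–102 [Balaban1985RegularSpaces] ((1.19)–(1.20) p.79, (1.30) p.81).
-/

set_option autoImplicit false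

noncomputable section

open scoped BigOperators Matrix.Norms.L2Operator
open NormedSpace

namespace Summit.QuantumFields.YangMills.Theorems.HalvingDbarStairUnitary

open Literature.MathematicalPhysics.QuantumFieldTheory.Balaban1983to89
open T4Continuum BlockAveraging ExpMeanLog
open B14DomainGeom (Pt)
open Node00 (coverAt coverAt_apply blockOf_coverAt coverAt_add_e)
open B7Prop1Explicit (e e_apply boxVec U1 mem_U1)
open B7Prop1Local (InBox bondHi)
open B8Ineq130 (tlo thi tlo_succ_apply thi_succ_apply)
open B10Eq27TorusAxialLog (holT)
open Summit.QuantumFields.YangMills.Theorems.Prop8ChartDoubleBar (dbarIterU dbarIterU_zero dbarIterU_succ pred_dbarAvgU holT_pred_of_walk coe_units_inv_mem_unitaryGroup)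
open HalvingCombStepGeometry (lift_twoBlock_bond norm_sub_le_of_inv_mul)
open HalvingDbarStairSizes (lift_block_bond le_and_le_of_boxVec)

variable {P : Params}

/-! ## §1 Label-box bookkeeping: the blow-ups `[tlo L lo n, thi L hi n]` are nested under blocking -/

section Boxes

/-- **The corner box of an `L`-bond of the level-`n` label box lies in the level-`(n+1)` label box**: if `tlo L lo n ≤ z` and `z + e_κ ≤ thi L hi n`, every point of
`Q = [Lz, bondHi L (Lz) κ]` lies in `[tlo L lo (n+1), thi L hi (n+1)]` (`tlo (n+1) = L·tlo n`, `thi (n+1) = L(thi n + 1) − 1`). [cite: Balaban1985RegularSpaces, (1.30) p.81] (bookkeeping) -/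
theorem inBox_succ_of_inBox_bondHi {d L : ℕ} (lo hi z : Pt d) (κ : Fin d) (n : ℕ) (hz : tlo L lo n ≤ z) (hzκ : z + e κ ≤ thi L hi n)
    {x : Pt d} (hx : InBox ((L : ℤ) • z) (bondHi L ((L : ℤ) • z) κ) x) (i : Fin d) :
    tlo L lo (n + 1) i ≤ x i ∧ x i ≤ thi L hi (n + 1) i := by
  have h1 := hx i
  have hzi := hz i
  have hzκi := hzκ i
  simp only [bondHi, Pi.smul_apply, smul_eq_mul, Pi.add_apply, e_apply] at h1 hzκi
  rw [tlo_succ_apply, thi_succ_apply]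
  have hL0 : (0 : ℤ) ≤ (L : ℤ) := Int.natCast_nonneg _
  constructor
  · nlinarith [h1.1]
  · split_ifs at h1 hzκi with hκ
    · nlinarith [h1.2]
    · nlinarith [h1.2]

/-- **A block of the level-`n` label box lies in the level-`(n+1)` label box**: `tlo L lo n ≤ w ≤ thi L hi n` ⇒ `Lw + r ∈ [tlo L lo (n+1), thi L hi (n+1)]`, `r ∈ [0, L)ᵈ`.
[cite: Balaban1985RegularSpaces, (1.30) p.81] (bookkeeping) -/
theorem boxVec_mem_succ {d L : ℕ} (lo hi w : Pt d) (n : ℕ) (hw : InBox (tlo L lo n) (thi L hi n) w) (r : Fin d → Fin L) (i : Fin d) :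
    tlo L lo (n + 1) i ≤ ((L : ℤ) • w + boxVec L r) i ∧ ((L : ℤ) • w + boxVec L r) i ≤ thi L hi (n + 1) i := by
  have h1 := hw i
  have hr := (r i).isLt
  simp only [Pi.smul_apply, smul_eq_mul, Pi.add_apply, boxVec]
  rw [tlo_succ_apply, thi_succ_apply]
  have hL0 : (0 : ℤ) ≤ (L : ℤ) := Int.natCast_nonneg _
  constructor
  · nlinarith [h1.1]
  · have : ((r i : ℕ) : ℤ) ≤ (L : ℤ) - 1 := by omega
    nlinarith [h1.2]

/-- The blow-ups are monotone in the corners: `[tlo L lo′ n, thi L hi′ n] ⊂ [tlo L lo n, thi L hi n]` for `lo ≤ lo′`, `hi′ ≤ hi` (`tlo L lo n = Lⁿ·lo`, `thi L hi n = Lⁿ(hi + 1) − 1`).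
[cite: Balaban1985RegularSpaces, (1.30) p.81] (bookkeeping) -/
theorem inBox_tlo_thi_mono {d L : ℕ} {lo lo' hi hi' : Pt d} (hlo : lo ≤ lo') (hhi : hi' ≤ hi) (n : ℕ) {w : Pt d}
    (hw : InBox (tlo L lo' n) (thi L hi' n) w) : InBox (tlo L lo n) (thi L hi n) w := fun i => by
  have h := hw i
  rw [B8Ineq130.tlo_apply, B8Ineq130.thi_apply] at h ⊢
  have hLn : (0 : ℤ) ≤ (L : ℤ) ^ n := by positivity
  exact ⟨(mul_le_mul_of_nonneg_left (hlo i) hLn).trans h.1, h.2.trans (by nlinarith [hhi i])⟩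

end Boxes

/-! ## §2 ★★ The label-box induction: a multiplicative `eml`-stable predicate climbs the double-bar tower under PER-LEVEL smallness -/

section Tower

/-- ★★ **THE DOUBLE-BAR TOWER PRESERVES A MULTIPLICATIVE `eml`-STABLE PREDICATE ON THE LABEL BOXES, WITH PER-LEVEL (k-UNIFORM) SMALLNESS.**  Data: a fine torus field `X`
on which `p` holds everywhere; a family of `ℤᵈ` fields `C i` (the comb tower) with the DEFECT ROW `‖(U̿^{(i)}X)(π_i x, μ)⁻¹·C_i(x, μ) − 1‖ ≤ r i ≤ r⋆` everywhere and the
TOWER ROW `‖C_i(x, μ) − 1‖ ≤ s` on the label box `[tlo L lo (k−i), thi L hi (k−i)]`; windows `s, r⋆ ≤ 1∕200`, `12ℓ·(s + (102∕100)r⋆) ≤ 1`.  Then `p ((U̿^{(i)}X)(π_i x, μ))` for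
every `i ≤ k` and every bond `(x, μ)` of the level-`i` label box — by induction on the level: the two-block bonds of a coarse bond of the level-`(i+1)` box lift into the
level-`i` box (★w3 g10 ✓`lift_twoBlock_bond`, `inBox_succ_of_inBox_bondHi`), are `(s + (102∕100)r_i)`-small there (✓`norm_sub_le_of_inv_mul`), and one double-bar step
preserves `p` (✓`Prop8ChartDoubleBarSU2.pred_dbarAvgU`).  No `Lⁱ` enters. [cite: Balaban1987RG1, (0.4)-(0.9) p.253; Balaban1985Averaging, (89) p.31, (110) p.34, Prop. 4 (134)-(135) pp.38-39] -/
theorem pred_dbarIterU_of_levelSmall (p : Matrix (Fin 2) (Fin 2) ℂ → Prop) (h1 : p 1) (hmul : ∀ a b, p a → p b → p (a * b))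
    (hinv : ∀ u : (Matrix (Fin 2) (Fin 2) ℂ)ˣ, p (u : Matrix (Fin 2) (Fin 2) ℂ) → p ((u⁻¹ : (Matrix (Fin 2) (Fin 2) ℂ)ˣ) : Matrix (Fin 2) (Fin 2) ℂ))
    (heml : ∀ W : Idx P → Matrix (Fin 2) (Fin 2) ℂ, (∀ i, p (W i)) → (∀ i, ‖W i - 1‖ ≤ 1 / 3) → p (eml W))
    {k : ℕ} (hroom : k + 1 ≤ P.m + P.K) (X : GaugeField P 0 (Matrix (Fin 2) (Fin 2) ℂ)ˣ)
    (hpX : ∀ b : PBond P 0, p ((X b : (Matrix (Fin 2) (Fin 2) ℂ)ˣ) : Matrix (Fin 2) (Fin 2) ℂ))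
    (C : ℕ → Pt P.d → Fin P.d → (Matrix (Fin 2) (Fin 2) ℂ)ˣ) (lo hi : Pt P.d) {s rs : ℝ} {r : ℕ → ℝ}
    (hs0 : 0 ≤ s) (hsw : s ≤ 1 / 200) (hr1 : ∀ i, i ≤ k → r i ≤ rs) (hrs : rs ≤ 1 / 200)
    (hθw : 12 * (((P.d + 2) * P.L : ℕ) : ℝ) * (s + 102 / 100 * rs) ≤ 1)
    (htow : ∀ i, i ≤ k → ∀ (x : Pt P.d) (μ : Fin P.d), tlo P.L lo (k - i) ≤ x → x + e μ ≤ thi P.L hi (k - i) →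
      ‖((C i x μ : (Matrix (Fin 2) (Fin 2) ℂ)ˣ) : Matrix (Fin 2) (Fin 2) ℂ) - 1‖ ≤ s)
    (hdef : ∀ i, i ≤ k → ∀ (x : Pt P.d) (μ : Fin P.d),
      ‖((((dbarIterU i X) ⟨coverAt P i x, μ⟩)⁻¹ * C i x μ : (Matrix (Fin 2) (Fin 2) ℂ)ˣ) : Matrix (Fin 2) (Fin 2) ℂ) - 1‖ ≤ r i) :
    ∀ i, i ≤ k → ∀ (x : Pt P.d) (μ : Fin P.d), tlo P.L lo (k - i) ≤ x → x + e μ ≤ thi P.L hi (k - i) →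
      p (((dbarIterU i X) ⟨coverAt P i x, μ⟩ : (Matrix (Fin 2) (Fin 2) ℂ)ˣ) : Matrix (Fin 2) (Fin 2) ℂ) := by
  intro i
  induction i with
  | zero =>
    intro _ x μ _ _
    rw [dbarIterU_zero]
    exact hpX _
  | succ i ih =>
    intro hik z κ hz hzκ
    have hile : i ≤ k := Nat.le_of_succ_le hik
    have hi2 : i + 2 ≤ P.m + P.K := by omega
    have hn : k - i = (k - (i + 1)) + 1 := by omega
    set n : ℕ := k - (i + 1) with hn'
    -- the smallness radius at level `i`
    set S : ℝ := s + 102 / 100 * rs with hS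
    have hS0 : 0 ≤ S := by
      have : r i ≤ rs := hr1 i hile
      have : 0 ≤ r i := (norm_nonneg _).trans (hdef i hile 0 ⟨0, P.hd⟩)
      rw [hS]; nlinarith
    -- the two-block readings of the coarse bond `ĉ = ⟨π_{i+1} z, κ⟩`
    have hread : ∀ b : PBond P i,
        (blockOf b.src = coverAt P (i + 1) z ∨ blockOf b.src = (⟨coverAt P (i + 1) z, κ⟩ : PBond P (i + 1)).tgt) →
        (blockOf b.tgt = coverAt P (i + 1) z ∨ blockOf b.tgt = (⟨coverAt P (i + 1) z, κ⟩ : PBond P (i + 1)).tgt) →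
        ‖((dbarIterU i X b : (Matrix (Fin 2) (Fin 2) ℂ)ˣ) : Matrix (Fin 2) (Fin 2) ℂ) - 1‖ ≤ S ∧
          p ((dbarIterU i X b : (Matrix (Fin 2) (Fin 2) ℂ)ˣ) : Matrix (Fin 2) (Fin 2) ℂ) := by
      intro b hbs hbt
      obtain ⟨x, hxs, hxt, hxQ, hxeQ⟩ := lift_twoBlock_bond hi2 z κ b hbs hbt
      have hlo : tlo P.L lo (k - i) ≤ x := fun j => by rw [hn]; exact (inBox_succ_of_inBox_bondHi lo hi z κ n hz hzκ hxQ j).1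
      have hhi : x + e b.dir ≤ thi P.L hi (k - i) := fun j => by rw [hn]; exact (inBox_succ_of_inBox_bondHi lo hi z κ n hz hzκ hxeQ j).2
      have hC : ‖((C i x b.dir : (Matrix (Fin 2) (Fin 2) ℂ)ˣ) : Matrix (Fin 2) (Fin 2) ℂ) - 1‖ ≤ s := htow i hile x b.dir hlo hhi
      have hHb : ‖((((dbarIterU i X b)⁻¹ * C i x b.dir : (Matrix (Fin 2) (Fin 2) ℂ)ˣ)) : Matrix (Fin 2) (Fin 2) ℂ) - 1‖ ≤ r i := by
        have h := hdef i hile x b.dir; rw [hxs] at h; exact h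
      have hW := (norm_sub_le_of_inv_mul hHb hC hsw ((hr1 i hile).trans hrs)).2
      have hpb : p ((dbarIterU i X b : (Matrix (Fin 2) (Fin 2) ℂ)ˣ) : Matrix (Fin 2) (Fin 2) ℂ) := by
        have h := ih hile x b.dir hlo hhi; rw [hxs] at h; exact h
      refine ⟨hW.trans ?_, hpb⟩
      rw [hS]; nlinarith [hr1 i hile, (norm_nonneg _).trans hHb]
    rw [dbarIterU_succ]
    exact pred_dbarAvgU p h1 hmul hinv heml (by omega) (⟨coverAt P (i + 1) z, κ⟩ : PBond P (i + 1)) hS0 hθw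
      (fun b hbs hbt => (hread b hbs hbt).1) (fun b hbs hbt => (hread b hbs hbt).2)

/-- ★★ **… AND ALONG THE CENTRE STAIRS**: under the same data, for every `j < k` and every level-`(j+1)` label `w ∈ [tlo L lo (k−(j+1)), thi L hi (k−(j+1))]`, the centre-stair
transporters of `U̿^{(j)}X` in the block of `π_{j+1} w` satisfy `p` (their bonds lift into the block `B(Lw) ⊂` level-`j` box: ✓`lift_block_bond`, `boxVec_mem_succ`; products by
✓`holT_pred_of_walk`). [cite: Balaban1985Averaging, (9) p.18, (110) p.34; Balaban1987RG1, (0.3) p.252, (0.9) p.253] -/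
theorem pred_holT_stair_dbarIterU_of_levelSmall (p : Matrix (Fin 2) (Fin 2) ℂ → Prop) (h1 : p 1) (hmul : ∀ a b, p a → p b → p (a * b))
    (hinv : ∀ u : (Matrix (Fin 2) (Fin 2) ℂ)ˣ, p (u : Matrix (Fin 2) (Fin 2) ℂ) → p ((u⁻¹ : (Matrix (Fin 2) (Fin 2) ℂ)ˣ) : Matrix (Fin 2) (Fin 2) ℂ))
    (heml : ∀ W : Idx P → Matrix (Fin 2) (Fin 2) ℂ, (∀ i, p (W i)) → (∀ i, ‖W i - 1‖ ≤ 1 / 3) → p (eml W))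
    {k : ℕ} (hroom : k + 1 ≤ P.m + P.K) (X : GaugeField P 0 (Matrix (Fin 2) (Fin 2) ℂ)ˣ)
    (hpX : ∀ b : PBond P 0, p ((X b : (Matrix (Fin 2) (Fin 2) ℂ)ˣ) : Matrix (Fin 2) (Fin 2) ℂ))
    (C : ℕ → Pt P.d → Fin P.d → (Matrix (Fin 2) (Fin 2) ℂ)ˣ) (lo hi : Pt P.d) {s rs : ℝ} {r : ℕ → ℝ}
    (hs0 : 0 ≤ s) (hsw : s ≤ 1 / 200) (hr1 : ∀ i, i ≤ k → r i ≤ rs) (hrs : rs ≤ 1 / 200)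
    (hθw : 12 * (((P.d + 2) * P.L : ℕ) : ℝ) * (s + 102 / 100 * rs) ≤ 1)
    (htow : ∀ i, i ≤ k → ∀ (x : Pt P.d) (μ : Fin P.d), tlo P.L lo (k - i) ≤ x → x + e μ ≤ thi P.L hi (k - i) →
      ‖((C i x μ : (Matrix (Fin 2) (Fin 2) ℂ)ˣ) : Matrix (Fin 2) (Fin 2) ℂ) - 1‖ ≤ s)
    (hdef : ∀ i, i ≤ k → ∀ (x : Pt P.d) (μ : Fin P.d),
      ‖((((dbarIterU i X) ⟨coverAt P i x, μ⟩)⁻¹ * C i x μ : (Matrix (Fin 2) (Fin 2) ℂ)ˣ) : Matrix (Fin 2) (Fin 2) ℂ) - 1‖ ≤ r i) :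
    ∀ j, j < k → ∀ w : Pt P.d, InBox (tlo P.L lo (k - (j + 1))) (thi P.L hi (k - (j + 1))) w →
      ∀ idx : Idx P, p ((holT (dbarIterU j X) (emb (coverAt P (j + 1) w)) (stairWord idx.2.1 (off idx.1)) : (Matrix (Fin 2) (Fin 2) ℂ)ˣ) :
        Matrix (Fin 2) (Fin 2) ℂ) := by
  intro j hj w hw idx
  have hj1 : j + 1 ≤ P.m + P.K := by omega
  have hj2 : j + 2 ≤ P.m + P.K := by omega
  have hn : k - j = (k - (j + 1)) + 1 := by omega
  have hbond := pred_dbarIterU_of_levelSmall p h1 hmul hinv heml hroom X hpX C lo hi hs0 hsw hr1 hrs hθw htow hdef j hj.le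
  refine holT_pred_of_walk (fun u : (Matrix (Fin 2) (Fin 2) ℂ)ˣ => p (u : Matrix (Fin 2) (Fin 2) ℂ)) (by rw [Units.val_one]; exact h1)
    (fun a b ha hb => by rw [Units.val_mul]; exact hmul _ _ ha hb) hinv (dbarIterU j X) _ _ fun st hst => ?_
  obtain ⟨hs, ht⟩ := blockOf_ends_of_mem_stairWalk hj1 (coverAt P (j + 1) w) idx.1 idx.2.1 st hst
  obtain ⟨x, r', r'', hxs, hxt, hxr, hxr'⟩ := lift_block_bond hj2 w st.bond hs ht
  have hlo : tlo P.L lo (k - j) ≤ x := fun i => by rw [hn, hxr]; exact (boxVec_mem_succ lo hi w _ hw r' i).1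
  have hhi : x + e st.bond.dir ≤ thi P.L hi (k - j) := fun i => by rw [hn, hxr']; exact (boxVec_mem_succ lo hi w _ hw r'' i).2
  have h := hbond x st.bond.dir hlo hhi
  rw [hxs] at h
  exact h

/-- ★★ **UNITARITY**: the instance `p := (· ∈ U(2))` (✓`eml_mem_unitaryGroup`, ✓`coe_units_inv_mem_unitaryGroup`) — for a UNITARY-valued fine field, every bond of
`U̿^{(i)}X` on the level-`i` label box and every centre stair over the level-`(j+1)` label box is a unitary matrix, k-UNIFORMLY in the windows.
[cite: Balaban1987RG1, (0.9) p.253; Balaban1985Averaging, (110) p.34, Prop. 4 (134)-(135) pp.38-39] -/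
theorem holT_stair_dbarIterU_mem_unitaryGroup_of_levelSmall {k : ℕ} (hroom : k + 1 ≤ P.m + P.K) (X : GaugeField P 0 (Matrix (Fin 2) (Fin 2) ℂ)ˣ)
    (hXu : ∀ b : PBond P 0, ((X b : (Matrix (Fin 2) (Fin 2) ℂ)ˣ) : Matrix (Fin 2) (Fin 2) ℂ) ∈ Matrix.unitaryGroup (Fin 2) ℂ)
    (C : ℕ → Pt P.d → Fin P.d → (Matrix (Fin 2) (Fin 2) ℂ)ˣ) (lo hi : Pt P.d) {s rs : ℝ} {r : ℕ → ℝ}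
    (hs0 : 0 ≤ s) (hsw : s ≤ 1 / 200) (hr1 : ∀ i, i ≤ k → r i ≤ rs) (hrs : rs ≤ 1 / 200)
    (hθw : 12 * (((P.d + 2) * P.L : ℕ) : ℝ) * (s + 102 / 100 * rs) ≤ 1)
    (htow : ∀ i, i ≤ k → ∀ (x : Pt P.d) (μ : Fin P.d), tlo P.L lo (k - i) ≤ x → x + e μ ≤ thi P.L hi (k - i) →
      ‖((C i x μ : (Matrix (Fin 2) (Fin 2) ℂ)ˣ) : Matrix (Fin 2) (Fin 2) ℂ) - 1‖ ≤ s)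
    (hdef : ∀ i, i ≤ k → ∀ (x : Pt P.d) (μ : Fin P.d),
      ‖((((dbarIterU i X) ⟨coverAt P i x, μ⟩)⁻¹ * C i x μ : (Matrix (Fin 2) (Fin 2) ℂ)ˣ) : Matrix (Fin 2) (Fin 2) ℂ) - 1‖ ≤ r i) :
    (∀ i, i ≤ k → ∀ (x : Pt P.d) (μ : Fin P.d), tlo P.L lo (k - i) ≤ x → x + e μ ≤ thi P.L hi (k - i) →
      (((dbarIterU i X) ⟨coverAt P i x, μ⟩ : (Matrix (Fin 2) (Fin 2) ℂ)ˣ) : Matrix (Fin 2) (Fin 2) ℂ) ∈ Matrix.unitaryGroup (Fin 2) ℂ) ∧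
    (∀ j, j < k → ∀ w : Pt P.d, InBox (tlo P.L lo (k - (j + 1))) (thi P.L hi (k - (j + 1))) w →
      ∀ idx : Idx P, ((holT (dbarIterU j X) (emb (coverAt P (j + 1) w)) (stairWord idx.2.1 (off idx.1)) : (Matrix (Fin 2) (Fin 2) ℂ)ˣ) :
        Matrix (Fin 2) (Fin 2) ℂ) ∈ Matrix.unitaryGroup (Fin 2) ℂ) :=
  ⟨pred_dbarIterU_of_levelSmall (fun M : Matrix (Fin 2) (Fin 2) ℂ => M ∈ Matrix.unitaryGroup (Fin 2) ℂ) (Submonoid.one_mem _)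
      (fun _ _ ha hb => Submonoid.mul_mem _ ha hb) (fun _ hu => coe_units_inv_mem_unitaryGroup hu) (fun _ hW hs' => eml_mem_unitaryGroup hW hs')
      hroom X hXu C lo hi hs0 hsw hr1 hrs hθw htow hdef,
    pred_holT_stair_dbarIterU_of_levelSmall (fun M : Matrix (Fin 2) (Fin 2) ℂ => M ∈ Matrix.unitaryGroup (Fin 2) ℂ) (Submonoid.one_mem _)
      (fun _ _ ha hb => Submonoid.mul_mem _ ha hb) (fun _ hu => coe_units_inv_mem_unitaryGroup hu) (fun _ hW hs' => eml_mem_unitaryGroup hW hs')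
      hroom X hXu C lo hi hs0 hsw hr1 hrs hθw htow hdef⟩

end Tower

/-! ## §3 ★★★ The member level: row (F-hU) of (B-al-4)₃ in the B-al-3 door's guard letters -/

section Member

open Literature.MathematicalPhysics.QuantumFieldTheory.Balaban1983to89.T3ContinuumYM3Torus
open B7Prop1Explicit renaming Site → LSite
open B7Prop2Explicit (avgIter mem_unitaryUnits)
open B10Eq27TorusAxialLog (pull unitsField toUField unitsField_mem_unitaryUnits)

variable (F : T3Family) {n K : ℕ}

/-- ★★★ **ROW (F-hU) OF (B-al-4)₃ — THE CENTRE STAIRS OF THE TORUS DOUBLE-BAR TOWER OF THE PRE-GAUGED MEMBER FIELD ARE UNITARY, k-UNIFORMLY IN THE WINDOWS.**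
Member `(F, n, K)`, `k = K − n`, fine `SU(2)` field `U`, pre-gauge `gJ`, `X̂ := unitsField (toUField (gJ•U))` (unitary-valued), `U′ := pull X̂ 0`, `C_j = avgIter L U′ j`, `D_j = U̿^{(j)}X̂`.
HYPOTHESES (all in the B-al-3 door ✓`HalvingHStokesRowOfCombDefect.hStokes_of_rows`' row-`hG` guard letters, with the territory corners `lo hi` abstract — the door reads
`lo := tLo a ρ′`, `hi := tHi a M′ ρ′`): the TOWER ROW `‖C_{k−m′}(x, ν) − 1‖ < s` on `[tlo L lo m′, thi L hi m′]`, `m′ ≤ k`; the PER-LEVEL DEFECT ROW `hdef` (B-al-2's invariant, any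
`r ≤ r⋆`); the windows `s, r⋆ ≤ 1∕200`, `12ℓ(s + (102∕100)r⋆) ≤ 1` (`ℓ = (d+2)L`; the assembly pins `s = O(ε₀)`, `r⋆ = O(ε₀²)`).  CONCLUSION (the skeleton `hG_of_rows`' row `hStairU`
on the `[tlo L lo ·, thi L hi ·]` label boxes): for `j < k`, every label `w` of the level-`(j+1)` box and every stair index, `D_j(Γ_idx(π_{j+1} w)) ∈ U(2)`.  No `Lʲ` budget: the
smallness used at level `j` is `s + (102∕100)r_j` (§2). [cite: Balaban1987RG1, (0.4)-(0.9) p.253; Balaban1985Averaging, (19) p.21, (89) p.31, (110) p.34, Prop. 4 (134)-(135) pp.38-39; Balaban1985RegularSpaces, (1.19)-(1.20) p.79, (1.30) p.81] -/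
theorem stairUnitary_of_levelDefect {s rs : ℝ} {r : ℕ → ℝ} (lo hi : LSite (F.P K).d)
    (hs0 : 0 ≤ s) (hsw : s ≤ 1 / 200) (hr1 : ∀ j, j ≤ K - n → r j ≤ rs) (hrs : rs ≤ 1 / 200)
    (hθw : 12 * ((((F.P K).d + 2) * (F.P K).L : ℕ) : ℝ) * (s + 102 / 100 * rs) ≤ 1)
    (U : GaugeField (F.P K) 0 (Matrix.specialUnitaryGroup (Fin 2) ℂ)) (gJ : GaugeTransf (F.P K) 0 (Matrix.specialUnitaryGroup (Fin 2) ℂ))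
    (htow : ∀ m', m' ≤ K - n → ∀ (x : LSite (F.P K).d) (ν : Fin (F.P K).d), tlo (F.P K).L lo m' ≤ x → x + e ν ≤ thi (F.P K).L hi m' →
      ‖((avgIter (F.P K).L (pull (unitsField (toUField (GaugeField.gaugeAct gJ U))) 0) (K - n - m') x ν : (Matrix (Fin 2) (Fin 2) ℂ)ˣ) :
        Matrix (Fin 2) (Fin 2) ℂ) - 1‖ < s)
    (hdef : ∀ j, j ≤ K - n → ∀ (x : LSite (F.P K).d) (μ : Fin (F.P K).d),
      ‖((((dbarIterU j (unitsField (toUField (GaugeField.gaugeAct gJ U)))) ⟨coverAt (F.P K) j x, μ⟩)⁻¹ *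
            avgIter (F.P K).L (pull (unitsField (toUField (GaugeField.gaugeAct gJ U))) 0) j x μ : (Matrix (Fin 2) (Fin 2) ℂ)ˣ) :
          Matrix (Fin 2) (Fin 2) ℂ) - 1‖ ≤ r j) :
    ∀ j, j < K - n → ∀ w : LSite (F.P K).d,
      InBox (tlo (F.P K).L lo (K - n - (j + 1))) (thi (F.P K).L hi (K - n - (j + 1))) w →
      ∀ i : Idx (F.P K), ((holT (dbarIterU j (unitsField (toUField (GaugeField.gaugeAct gJ U)))) (emb (coverAt (F.P K) (j + 1) w)) (stairWord i.2.1 (off i.1)) :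
          (Matrix (Fin 2) (Fin 2) ℂ)ˣ) : Matrix (Fin 2) (Fin 2) ℂ) ∈ Matrix.unitaryGroup (Fin 2) ℂ := by
  set X : GaugeField (F.P K) 0 (Matrix (Fin 2) (Fin 2) ℂ)ˣ := unitsField (toUField (GaugeField.gaugeAct gJ U)) with hX
  have hroom : K - n + 1 ≤ (F.P K).m + (F.P K).K := by show K - n + 1 ≤ F.m + K; have := F.hm; omega
  have hXu : ∀ b : PBond (F.P K) 0, ((X b : (Matrix (Fin 2) (Fin 2) ℂ)ˣ) : Matrix (Fin 2) (Fin 2) ℂ) ∈ Matrix.unitaryGroup (Fin 2) ℂ :=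
    fun b => mem_unitaryUnits.mp (unitsField_mem_unitaryUnits _ b)
  have htow' : ∀ i, i ≤ K - n → ∀ (x : LSite (F.P K).d) (μ : Fin (F.P K).d), tlo (F.P K).L lo (K - n - i) ≤ x → x + e μ ≤ thi (F.P K).L hi (K - n - i) →
      ‖((avgIter (F.P K).L (pull X 0) i x μ : (Matrix (Fin 2) (Fin 2) ℂ)ˣ) : Matrix (Fin 2) (Fin 2) ℂ) - 1‖ ≤ s := by
    intro i hik x μ hlo hhi
    have h := htow (K - n - i) (by omega) x μ hlo hhi
    have hidx : K - n - (K - n - i) = i := by omega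
    rw [hidx] at h
    exact h.le
  exact (holT_stair_dbarIterU_mem_unitaryGroup_of_levelSmall hroom X hXu (fun i => avgIter (F.P K).L (pull X 0) i) lo hi hs0 hsw hr1 hrs hθw htow' hdef).2

/-- ★★★ **THE SAME ON SUB-BOXES** `[tlo L lo′ ·, thi L hi′ ·]`, `lo ≤ lo′`, `hi′ ≤ hi` — e.g. the skeleton's `sqLo L a ρ′ k k = a − ρ′ ≥ tLo a ρ′ = a − 2ρ′`,
`sqHi L a M′ ρ′ k k = a + M′ − 1 + ρ′ ≤ tHi a M′ ρ′` (`gs L 0 = 1`). [cite: Balaban1985RegularSpaces, (1.30) p.81, p.98] -/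
theorem stairUnitary_of_levelDefect_subbox {s rs : ℝ} {r : ℕ → ℝ} (lo hi lo' hi' : LSite (F.P K).d) (hlo : lo ≤ lo') (hhi : hi' ≤ hi)
    (hs0 : 0 ≤ s) (hsw : s ≤ 1 / 200) (hr1 : ∀ j, j ≤ K - n → r j ≤ rs) (hrs : rs ≤ 1 / 200)
    (hθw : 12 * ((((F.P K).d + 2) * (F.P K).L : ℕ) : ℝ) * (s + 102 / 100 * rs) ≤ 1)
    (U : GaugeField (F.P K) 0 (Matrix.specialUnitaryGroup (Fin 2) ℂ)) (gJ : GaugeTransf (F.P K) 0 (Matrix.specialUnitaryGroup (Fin 2) ℂ))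
    (htow : ∀ m', m' ≤ K - n → ∀ (x : LSite (F.P K).d) (ν : Fin (F.P K).d), tlo (F.P K).L lo m' ≤ x → x + e ν ≤ thi (F.P K).L hi m' →
      ‖((avgIter (F.P K).L (pull (unitsField (toUField (GaugeField.gaugeAct gJ U))) 0) (K - n - m') x ν : (Matrix (Fin 2) (Fin 2) ℂ)ˣ) :
        Matrix (Fin 2) (Fin 2) ℂ) - 1‖ < s)
    (hdef : ∀ j, j ≤ K - n → ∀ (x : LSite (F.P K).d) (μ : Fin (F.P K).d),
      ‖((((dbarIterU j (unitsField (toUField (GaugeField.gaugeAct gJ U)))) ⟨coverAt (F.P K) j x, μ⟩)⁻¹ *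
            avgIter (F.P K).L (pull (unitsField (toUField (GaugeField.gaugeAct gJ U))) 0) j x μ : (Matrix (Fin 2) (Fin 2) ℂ)ˣ) :
          Matrix (Fin 2) (Fin 2) ℂ) - 1‖ ≤ r j) :
    ∀ j, j < K - n → ∀ w : LSite (F.P K).d,
      InBox (tlo (F.P K).L lo' (K - n - (j + 1))) (thi (F.P K).L hi' (K - n - (j + 1))) w →
      ∀ i : Idx (F.P K), ((holT (dbarIterU j (unitsField (toUField (GaugeField.gaugeAct gJ U)))) (emb (coverAt (F.P K) (j + 1) w)) (stairWord i.2.1 (off i.1)) :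
          (Matrix (Fin 2) (Fin 2) ℂ)ˣ) : Matrix (Fin 2) (Fin 2) ℂ) ∈ Matrix.unitaryGroup (Fin 2) ℂ :=
  fun j hj w hw i => stairUnitary_of_levelDefect F lo hi hs0 hsw hr1 hrs hθw U gJ htow hdef j hj w (inBox_tlo_thi_mono hlo hhi _ hw) i

end Member


end Summit.QuantumFields.YangMills.Theorems.HalvingDbarStairUnitary

end
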